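import Summits.Ventures.QEC.CircuitDistance.PortK2DataBB144Z
import Summits.Ventures.QEC.CircuitDistance.K2Chunks
import HarnessLib

/-!
# K2(`[[144,12,12]]`) chunk module — COMPUTATIONAL (native_decide; `Lean.ofReduceBool`)

Cell `qec`, CDX, R146/R152 STEP 1 («computational» header; `ofReduceBool` confined to these chunk modules). Checker of record
`K2.K2Data` (qec-cdx-type-1, PortK2Check); data module of record `PortK2DataBB144X/Z` (p669158/9, crit-1 data audit PASS
2026-08-28T21:20Z); chunk glue `K2Chunks` (idea-1 g2). Cube 0, child 10: leaf group 4 of 5.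
Leaf theorems: the K2 DFS accepts below one descendant state of pivot cube 0 (sector Z); sizes are exact DFS visit counts
(eng-1 g2 `k2count.c`), capped so that the gate's native-axiom audit re-verifies every leaf in place. Assemblies re-derive the
child lists in the kernel (`decide`) and end in the literal cube fact `d144Z.cube (Ts144Z.getD 0 []) (0) (lives144Z.getD 0 0) = true`
(the `hcubes` hypothesis of `K2Inst.k2_complete`). Emitted by qec-cdx-eng-1 g2 (`gen2.py`, idea-1's `gen_k2chunks_from_lean.py` lineage).
-/

namespace Summit.Ventures.QEC.CircuitDistance.K2

set_option maxRecDepth 100000 in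
set_option maxHeartbeats 0 in
set_option exponentiation.threshold 1024 in
/-- K2(144) chunk fact `cube144Z0_ch10_14` (367693 DFS visits; see the module docstring). -/
theorem cube144Z0_ch10_14 : app5 (d144Z.dfs (Ts144Z.getD 0 []) 6) (2361201255867795678208, 460, 56539106072908298547048643908989864721069071456807383955796083221909733377, 3, 2348542582773833227889480596789336970835699435235005578623584743767514228350176184360650046549365931806556124) = true := by native_decide

set_option maxRecDepth 100000 in
set_option maxHeartbeats 0 in
set_option exponentiation.threshold 1024 in
/-- K2(144) chunk fact `cube144Z0_ch10_15` (337122 DFS visits; see the module docstring). -/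
theorem cube144Z0_ch10_15 : app5 (d144Z.dfs (Ts144Z.getD 0 []) 6) (18014435221187584, 2504, 3618502788666131106986976405406713592629276607558055203528954185027831201793, 3, 2348542582773833227889480596789333352332910769103898592030303222270393813663155383093023813499865684521254876) = true := by native_decide

set_option maxRecDepth 100000 in
set_option maxHeartbeats 0 in
set_option exponentiation.threshold 1024 in
/-- K2(144) chunk fact `cube144Z0_ch10_16` (452482 DFS visits; see the module docstring). -/
theorem cube144Z0_ch10_16 : app5 (d144Z.dfs (Ts144Z.getD 0 []) 6) (297471797805875995648, 1856, 3978585891278293137243057985174567103927534422850996329110468602722571880785047550164993, 3, 2348542582773833227885502010898055059195667711118724025309499573064015031923631671277878537523765417516990428) = true := by native_decide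

set_option maxRecDepth 100000 in
set_option maxHeartbeats 0 in
set_option exponentiation.threshold 1024 in
/-- K2(144) chunk fact `cube144Z0_ch10_17` (403457 DFS visits; see the module docstring). -/
theorem cube144Z0_ch10_17 : app5 (d144Z.dfs (Ts144Z.getD 0 []) 6) (1180609916625325401344, 472, 31828687130226345097944463881396534149553078867502468505776451308739503713486916580016129, 3, 2348542582773833227853673323767828714097723247237327491543070379412984778007441976756716329714963281482874844) = true := by native_decide

set_option maxRecDepth 100000 in
set_option maxHeartbeats 0 in
set_option exponentiation.threshold 1024 in
/-- K2(144) chunk fact `cube144Z0_ch10_18` (406041 DFS visits; see the module docstring). -/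
theorem cube144Z0_ch10_18 : app5 (d144Z.dfs (Ts144Z.getD 0 []) 6) (54043229956383808, 136, 4074071952668972172536891376818756322486060672548344715861867655496339895431358192912695297, 3, 2348542582773833223779601371098856541560831870418571169440133592081112276735161078047953730188289869116080092) = true := by native_decide
end Summit.Ventures.QEC.CircuitDistance.K2
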